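import Literature.NumberTheory.Automorphic.CuspidalRepFinWhittakerUnique
import Literature.NumberTheory.Automorphic.ArchWhittakerTranslate
import HarnessLib

/-!
# Factorization `W_φ((g_∞, g_f)) = W_f(g_f) · W_∞(g_∞)` of the Whittaker functions of a cuspidal
# representation along `π ≅ π_∞ ⊗ π_f`, from FINITE-adelic multiplicity one alone

Topic `NumberTheory/Automorphic`; namespace `Literature.NumberTheory.Automorphic`. Theorems only.

Let `Π ≤ L²_cusp(GL_n(K) A_G \ GL_n(𝔸_K))` be a cuspidal automorphic representation with archimedean
component `τ` on `E` (irreducible unitary strongly continuous; `CuspidalRepArchIsotypic`), smooth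
multiplicity module `M = ⋃_{U₀} Hom_{G_∞}(τ, Π^{U₀}) ≅ π_f` (`CuspidalRepFiniteComponent`), and let `ℓ`
be a non-zero continuous `ψ`-Whittaker functional on the Gårding space of `Π` with transfer map
`Φ_ℓ : M → (Gårding τ)^*`, `Φ_ℓ(T)(v) = ℓ(T̂ v)` (`WhittakerUniquenessReduction`). In print
`Λ = ⊗_v Λ_v` (Cogdell (2004), §1.2, proof of Cor. 1.4) by local uniqueness at EVERY place. This file
observes that the uniqueness of the `ψ_f`-Whittaker functionals on `M` — a THEOREM of the tree
(`exists_eq_smul_of_mem_finWhittakerFunctionals`, `CuspidalRepFinWhittakerUnique`: Flath's theorem and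
non-archimedean local multiplicity one) — already forces all the transferred ARCHIMEDEAN functionals
to lie on one line, with no appeal to Shalika's archimedean multiplicity one:

* `exists_finWhittaker_transferMap_eq_smul` — there are `T₀ ∈ M` and a `ψ_f`-Whittaker functional
  `Λ₀` on `M`, `Λ₀(T₀) = 1`, with `Φ_ℓ(T) = Λ₀(T) · Φ_ℓ(T₀)` for all `T ∈ M` and
  `ℓ_∞ := Φ_ℓ(T₀) ≠ 0`. (For `v` fixed, `T ↦ Φ_ℓ(T)(v)` is a `ψ_f`-Whittaker functional on `M`; any
  two are proportional.)
* `whittakerCoeff_eq_finWhittaker_mul_transferMap` — consequently, for a vector `T̂ e`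
  (`T ∈ M`, `e` Gårding) fixed by a test function `η`, the global Whittaker function factors:
  `W_{S_η (T̂ e)}(g) = Λ₀(g_f · T) · ℓ_∞(τ(g_∞) e)` with `g = (g_∞, g_f)` (`g_f · T = R((1, g_f)) ∘ T`),
  i.e. `W_φ = W_f · W_∞` for `φ = e ⊗ T` (Cogdell (2004), §1.1–§1.2: "`W_φ(g) = ∏_v W_{φ_v}(g_v)` for
  factorizable `φ`").

## References

* J. W. Cogdell, *Lectures on L-functions, converse theorems, and functoriality for GL_n* (2004),
  §1.1–§1.2, Cor. 1.4 and its proof [CogdellAnalyticTheory2004].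
* D. Bump, *Automorphic forms and representations* (1997), Thm. 3.5.2 [Bump1997].
-/

noncomputable section

open MeasureTheory Measure NumberField NumberField.mixedEmbedding IsDedekindDomain Set Filter
open scoped MatrixGroups InnerProductSpace Classical NNReal

namespace Literature.NumberTheory.Automorphic

variable {n : ℕ} {K : Type} [Field K] [NumberField K]
  {μ : Measure (AdelicGroupData.gl n K).automorphicQuotient}
  [(AdelicGroupData.gl n K).IsAutomorphicMeasure μ]

-- the house Borel structures on `GL_n(𝔸_K)` (as in `ArchWhittakerTranslate`, whose lemmas are used)
attribute [local instance] adelicBorel borelSpace_adelic locallyCompactSpace_adelic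
  secondCountableTopology_gl_adelic glAdeleBorel borelSpace_glAdele

-- as in `ArchGardingWhittaker`: the scoped `L∞`-operator normed ring structure on matrices (through
-- which `IsArchSmooth` is defined) is only reducibly defeq to the Pi uniformity
set_option backward.isDefEq.respectTransparency false

section Line

variable {hcpt : isCompact_glFiniteIntegralLevel n K}
  {E : Type*} [NormedAddCommGroup E] [InnerProductSpace ℂ E] [CompleteSpace E]
  {τ : ContRepresentation ℂ (AutomorphyDatum.gl n K hcpt).arch.carrier E}

/-- **The transferred archimedean Whittaker functionals of a cuspidal representation span a line**
(from finite-adelic multiplicity one): for a non-zero continuous `ψ`-Whittaker functional `ℓ` on the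
Gårding space of a cuspidal `Π` with archimedean component `τ`, there are `T₀ ∈ M` and a
`ψ_f`-Whittaker functional `Λ₀` on the multiplicity module `M` with `Λ₀ T₀ = 1`,
`ℓ_∞ := Φ_ℓ(T₀) ≠ 0`, and `Φ_ℓ(T) = Λ₀(T) • ℓ_∞` for every `T ∈ M`. Proof: for each Gårding `v` of
`τ`, `T ↦ Φ_ℓ(T)(v)` is a `ψ_f`-Whittaker functional on `M` (`transferMap_finComponentRep_unipotent`),
and any two such are proportional (`exists_eq_smul_of_mem_finWhittakerFunctionals`).
[cite: CogdellAnalyticTheory2004, §1.2 (proof of Cor. 1.4)] -/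
theorem exists_finWhittaker_transferMap_eq_smul (P : CuspidalAutomorphicRepGL n K μ)
    (hτu : τ.IsUnitary) (hτi : τ.IsTopIrreducible) (hτ : τ.IsStronglyContinuous)
    (hex : ∃ T ∈ archIntertwiners hcpt τ P.1, T ≠ 0)
    {ℓ : gardingSpace P.1 →ₗ[ℂ] ℂ} (hℓ : IsContWhittakerFunctional P.1 (adeleAddChar K) ℓ) (hℓ0 : ℓ ≠ 0) :
    ∃ (T₀ : multiplicityModule hcpt τ P.1) (Λ₀ : multiplicityModule hcpt τ P.1 →ₗ[ℂ] ℂ),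
      Λ₀ ∈ finWhittakerFunctionals hcpt τ P.1 ∧ Λ₀ T₀ = 1 ∧ transferMap ℓ hτ T₀ ≠ 0 ∧
        ∀ T : multiplicityModule hcpt τ P.1, transferMap ℓ hτ T = Λ₀ T • transferMap ℓ hτ T₀ := by
  -- a non-zero transfer `Φ_ℓ(T₀)` and a vector `v₀` where it does not vanish
  have hex₁ : ∃ T₀ : multiplicityModule hcpt τ P.1, transferMap ℓ hτ T₀ ≠ 0 := by
    by_contra h
    push Not at h
    exact hℓ0 (eq_zero_of_transferMap_eq_zero P hτu hτi hτ hex h)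
  obtain ⟨T₀, hT₀⟩ := hex₁
  obtain ⟨v₀, hv₀⟩ : ∃ v₀ : archGardingSpace hcpt τ, transferMap ℓ hτ T₀ v₀ ≠ 0 := by
    by_contra h
    push Not at h
    exact hT₀ (LinearMap.ext fun v => h v)
  -- the `ψ_f`-Whittaker functionals `Λ_v : T ↦ Φ_ℓ(T)(v)`
  set Λ : archGardingSpace hcpt τ → (multiplicityModule hcpt τ P.1 →ₗ[ℂ] ℂ) :=
    fun v => (LinearMap.applyₗ v).comp (transferMap ℓ hτ) with hΛdef
  have hΛ : ∀ (v : archGardingSpace hcpt τ) (T : multiplicityModule hcpt τ P.1),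
      Λ v T = transferMap ℓ hτ T v := fun v T => rfl
  have hΛmem : ∀ v, Λ v ∈ finWhittakerFunctionals hcpt τ P.1 := fun v => by
    rw [mem_finWhittakerFunctionals_iff]
    intro u T
    rw [hΛ, hΛ, transferMap_finComponentRep_unipotent hℓ hτ u T, LinearMap.smul_apply, smul_eq_mul]
  have hΛ₀ne : Λ v₀ ≠ 0 := fun h => hv₀ (by rw [← hΛ, h, LinearMap.zero_apply])
  refine ⟨T₀, (transferMap ℓ hτ T₀ v₀)⁻¹ • Λ v₀, Submodule.smul_mem _ _ (hΛmem v₀), ?_, hT₀, fun T => ?_⟩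
  · rw [LinearMap.smul_apply, smul_eq_mul, hΛ, inv_mul_cancel₀ hv₀]
  · refine LinearMap.ext fun v => ?_
    obtain ⟨c, hc⟩ := exists_eq_smul_of_mem_finWhittakerFunctionals hcpt P hτu hτi hex (hΛmem v₀)
      (hΛmem v) hΛ₀ne
    have h1 : transferMap ℓ hτ T v = c * transferMap ℓ hτ T v₀ := by
      rw [← hΛ v T, hc, LinearMap.smul_apply, smul_eq_mul, hΛ]
    have h2 : transferMap ℓ hτ T₀ v = c * transferMap ℓ hτ T₀ v₀ := by
      rw [← hΛ v T₀, hc, LinearMap.smul_apply, smul_eq_mul, hΛ]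
    rw [LinearMap.smul_apply, LinearMap.smul_apply, smul_eq_mul, smul_eq_mul, hΛ, h1, h2]
    field_simp

end Line

/-! ### The factorization of the global Whittaker function of `e ⊗ T` -/

section Factorization

variable {hcpt : isCompact_glFiniteIntegralLevel n K}
  {E : Type*} [NormedAddCommGroup E] [InnerProductSpace ℂ E] [CompleteSpace E]
  {τ : ContRepresentation ℂ (AutomorphyDatum.gl n K hcpt).arch.carrier E}
  {W : ContRepresentation.ClosedSubrep ((AdelicGroupData.gl n K).rightRegular μ)}

omit [CompleteSpace E] in
/-- The vector `T̂ e ∈ Π` of an intertwiner `T ∈ M` at `e ∈ E`. [folklore] -/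
theorem apply_mem_of_mem_multiplicityModule (T : multiplicityModule hcpt τ W) (e : E) :
    (T : E →L[ℂ] (AdelicGroupData.gl n K).L2 μ) e ∈ W :=
  (mem_archIntertwiners_of_mem_multiplicityModule T.2).1 e

omit [CompleteSpace E] in
/-- **`R(g) (T̂ e) = (g_f · T)^(τ(g_∞) e)`**: the right translate of `T̂ e` by `g = (g_∞, g_f)` is
the vector of the translated intertwiner `g_f · T = R((1, g_f)) ∘ T` at `τ(g_∞) e`. [folklore] -/
theorem toContRep_apply_multiplicityModule (T : multiplicityModule hcpt τ W)
    (e : archGardingSpace hcpt τ) (g : GL (Fin n) (AdeleRing (𝓞 K) K)) :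
    W.toContRep g ⟨(T : E →L[ℂ] (AdelicGroupData.gl n K).L2 μ) (e : E), apply_mem_of_mem_multiplicityModule T e⟩ =
      ⟨((finComponentRep hcpt τ W (GLn.sndHom n K g) T : multiplicityModule hcpt τ W) :
          E →L[ℂ] (AdelicGroupData.gl n K).L2 μ) (τ (toArch hcpt (GLn.toMixed n K g)) (e : E)),
        apply_mem_of_mem_multiplicityModule _ _⟩ := by
  set T' : multiplicityModule hcpt τ W := finComponentRep hcpt τ W (GLn.sndHom n K g) T with hT'
  have hT'i : (T' : E →L[ℂ] (AdelicGroupData.gl n K).L2 μ) ∈ archIntertwiners hcpt τ W :=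
    mem_archIntertwiners_of_mem_multiplicityModule T'.2
  apply Subtype.ext
  rw [ContRepresentation.ClosedSubrep.coe_toContRep_apply]
  conv_lhs => rw [← GLn.ofInfinite_toMixed_mul_ofFinite_sndHom g]
  rw [map_mul]
  change (AdelicGroupData.gl n K).rightRegular μ (GLn.ofInfinite n K (GLn.toMixed n K g))
      ((AdelicGroupData.gl n K).rightRegular μ (GLn.ofFinite n K (GLn.sndHom n K g))
        ((T : E →L[ℂ] (AdelicGroupData.gl n K).L2 μ) (e : E))) = _
  have h1 : (AdelicGroupData.gl n K).rightRegular μ (GLn.ofFinite n K (GLn.sndHom n K g))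
      ((T : E →L[ℂ] (AdelicGroupData.gl n K).L2 μ) (e : E)) =
      (T' : E →L[ℂ] (AdelicGroupData.gl n K).L2 μ) (e : E) := by
    rw [hT', coe_finComponentRep_apply]; rfl
  rw [h1]
  have h2 := congrArg (fun x : W.toSubmodule => (x : (AdelicGroupData.gl n K).L2 μ))
    (corestrictW_apply_apply hT'i (GLn.toMixed n K g) (e : E))
  simp only [coe_corestrictW_apply, ContRepresentation.ClosedSubrep.coe_toContRep_apply] at h2
  exact h2.symm

/-- **Factorization of the global Whittaker function of `e ⊗ T`.** Let `Π` be cuspidal with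
archimedean component `τ`, `ℓ = whittakerFunctional ν₀` its Whittaker functional on the Gårding
space, and suppose `Φ_ℓ(T) = Λ₀(T) • ℓ_∞` for all `T ∈ M` (`exists_finWhittaker_transferMap_eq_smul`,
`ℓ_∞ = Φ_ℓ(T₀)`). If the vector `T̂ e` (`T ∈ M`, `e` a Gårding vector of `τ`) is fixed by the test
function `η`, `Π(η) (T̂ e) = T̂ e`, then for every `g ∈ GL_n(𝔸_K)`

  `W_{S_η (T̂ e)}(g) = Λ₀(g_f · T) · ℓ_∞(τ(g_∞) e)`,

`g_f = GLn.sndHom g`, `g_∞ = GLn.toMixed g`: the Whittaker function of `φ = e ⊗ T` is the product of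
the finite Whittaker function `g_f ↦ Λ₀(g_f · T)` of `T ∈ π_f` and the archimedean Whittaker function
`g_∞ ↦ ℓ_∞(τ(g_∞) e)` (Cogdell (2004), §1.1: `W_φ = ∏_v W_{φ_v}` for factorizable `φ`).
[cite: CogdellAnalyticTheory2004, §1.1–§1.2] -/
theorem whittakerCoeff_eq_finWhittaker_mul_transferMap (P : CuspidalAutomorphicRepGL n K μ)
    (hτ : τ.IsStronglyContinuous) (ν₀ : Measure ↥(adelicUnipotent n K)) [IsFiniteMeasureOnCompacts ν₀]
    {T₀ : multiplicityModule hcpt τ P.1} {Λ₀ : multiplicityModule hcpt τ P.1 →ₗ[ℂ] ℂ}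
    (hΛ : ∀ T : multiplicityModule hcpt τ P.1,
      transferMap (whittakerFunctional ν₀ (continuous_adeleAddChar K)
        (ContRepresentation.Equiv.refl P.1.toContRep)) hτ T =
        Λ₀ T • transferMap (whittakerFunctional ν₀ (continuous_adeleAddChar K)
          (ContRepresentation.Equiv.refl P.1.toContRep)) hτ T₀)
    (T : multiplicityModule hcpt τ P.1) (e : archGardingSpace hcpt τ)
    {η : GL (Fin n) (AdeleRing (𝓞 K) K) → ℝ} (hη : IsTestFunctionGL n K η)
    (hfix : smoothedVector P.1 η ⟨(T : E →L[ℂ] (AdelicGroupData.gl n K).L2 μ) (e : E),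
        apply_mem_of_mem_multiplicityModule T e⟩ =
      ⟨(T : E →L[ℂ] (AdelicGroupData.gl n K).L2 μ) (e : E), apply_mem_of_mem_multiplicityModule T e⟩)
    (g : GL (Fin n) (AdeleRing (𝓞 K) K)) :
    whittakerCoeff ν₀ (unipotentTateDomain n K) (adeleAddChar K)
        (invQuot (AdelicGroupData.gl n K)
          (smoothedForm η ((T : E →L[ℂ] (AdelicGroupData.gl n K).L2 μ) (e : E)))) g =
      Λ₀ (finComponentRep hcpt τ P.1 (GLn.sndHom n K g) T) *
        transferMap (whittakerFunctional ν₀ (continuous_adeleAddChar K)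
          (ContRepresentation.Equiv.refl P.1.toContRep)) hτ T₀
          ⟨τ (toArch hcpt (GLn.toMixed n K g)) (e : E), apply_mem_archGardingSpace hτ _ e.2⟩ := by
  -- `x = T̂ e` is a Gårding vector with continuous representative `S_η x`
  have hxg : (⟨(T : E →L[ℂ] (AdelicGroupData.gl n K).L2 μ) (e : E), apply_mem_of_mem_multiplicityModule T e⟩ :
      P.1.toSubmodule) ∈ gardingSpace P.1 :=
    corestrictW_mem_gardingSpace_of_mem_multiplicityModule T.2 hτ e.2
  have hrep : HasContRep (((⟨(T : E →L[ℂ] (AdelicGroupData.gl n K).L2 μ) (e : E),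
        apply_mem_of_mem_multiplicityModule T e⟩ : P.1.toSubmodule) : (AdelicGroupData.gl n K).L2 μ))
      (smoothedForm η ((T : E →L[ℂ] (AdelicGroupData.gl n K).L2 μ) (e : E))) := by
    have h := hasContRep_smoothedVector P.1 hη.continuous hη.hasCompactSupport
      ⟨(T : E →L[ℂ] (AdelicGroupData.gl n K).L2 μ) (e : E), apply_mem_of_mem_multiplicityModule T e⟩
    rw [hfix] at h
    exact h
  -- `W(g) = ℓ(R(g) x)`
  rw [← whittakerFunctional_toContRep_eq_whittakerCoeff ν₀ (continuous_adeleAddChar K) hxg hrep g]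
  -- `R(g) x = (g_f · T)^(τ(g_∞) e)` and `ℓ((g_f T)^ v) = Φ_ℓ(g_f T)(v) = Λ₀(g_f T) ℓ_∞(v)`
  set T' : multiplicityModule hcpt τ P.1 := finComponentRep hcpt τ P.1 (GLn.sndHom n K g) T with hT'
  set v : archGardingSpace hcpt τ := ⟨τ (toArch hcpt (GLn.toMixed n K g)) (e : E),
    apply_mem_archGardingSpace hτ _ e.2⟩ with hv
  have hmove : (⟨P.1.toContRep g ⟨(T : E →L[ℂ] (AdelicGroupData.gl n K).L2 μ) (e : E),
        apply_mem_of_mem_multiplicityModule T e⟩, toContRep_mem_gardingSpace g hxg⟩ : gardingSpace P.1) =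
      ⟨corestrictW (mem_archIntertwiners_of_mem_multiplicityModule T'.2) v,
        corestrictW_mem_gardingSpace_of_mem_multiplicityModule T'.2 hτ v.2⟩ := by
    apply Subtype.ext
    change P.1.toContRep g _ = corestrictW _ _
    rw [toContRep_apply_multiplicityModule T e g]
    rfl
  rw [hmove, ← transferMap_apply_apply (whittakerFunctional ν₀ (continuous_adeleAddChar K)
    (ContRepresentation.Equiv.refl P.1.toContRep)) hτ T' v, hΛ T', LinearMap.smul_apply, smul_eq_mul]

end Factorization

end Literature.NumberTheory.Automorphic
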